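import Mathlib
import Literature.MathematicalPhysics.QuantumLattice.SU2Haar
import Literature.MathematicalPhysics.QuantumFieldTheory.Balaban1983to89.UnitaryModel
import Summits.QuantumFields.YangMills.Theorems.BackwardLiouvilleRigidityFlatRatioTerminationOneBondChains

/-!
# Every `SU(2)` gauge transformation is a one-bond chain inside any strictly larger plaquette window
# (toolkit for the geometric stub `stub_innerWindowChains` of `BackwardLiouvilleRigidity.FlatRatioTermination`, stmt-QuantumFields-22542)

* §1 `exists_exp_eq_of_norm_eq_one` (every unit quaternion is `exp w` with `w` imaginary, `‖w‖ ≤ π` — Mathlib's closed form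
  `Quaternion.exp_of_re_eq_zero`) and `exists_pow_eq_dist1_le`: every `g ∈ SU(2)` is `h^K` with `dist1 h = ‖h − 1‖_op ≤ π/K` (through the tree's
  quaternion model `quatMatrix` / `su2Quat` / `quatToSU2` of `SU2Haar`).
* §6 `chain_gaugeAct_su2`: for `PlaqSmall θ₀ A` and `θ₀ < θ`, `A` is joined to `A^u` by at most `#PBond · (⌈8π/(θ − θ₀)⌉₊ + 1)` one-bond moves
  inside `PlaqSmall θ` (write `u = v^K`, `K` small transformations in a row, `chain_gaugeAct_of_small` of the companion file).
* `chain_one_gaugeAct_su2`: every pure gauge `1^u` is reached from the trivial configuration inside `PlaqSmall θ`, `θ > 0`, by at most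
  `#PBond · (⌈16π/θ⌉₊ + 1)` moves — stated in the chain format of the registered stub (`∀ e, W 0 e = 1`).
So, inside a window, configurations may be moved along their gauge orbits at a cost linear in `#PBond`; what the stub still needs is a gauge in
which the configuration is bondwise small (the global-gauge theorem sized in the item's evidence memo) plus a straight contraction.

HONEST SCOPE.  Helper lemmas `--supports stmt-QuantumFields-22542`; they do NOT prove the stub, the support, the crux `ClassLimitTrajectories`,
rung R3 or any summit statement; nothing here bears on the Yang–Mills mass gap.
-/

namespace Summit.QuantumFields.YangMills.Theorems.FlatRatioTermination

open Quaternion NormedSpace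
open Literature.MathematicalPhysics.QuantumLattice
open Literature.MathematicalPhysics.QuantumFieldTheory.Balaban1983to89
open scoped Matrix.Norms.L2Operator

/-! ## §1 Small `K`-th roots in `SU(2)` (quaternion model) -/

/-- Every unit quaternion is the exponential of an imaginary quaternion of norm `≤ π`. [folklore] -/
theorem exists_exp_eq_of_norm_eq_one (q : ℍ) (hq : ‖q‖ = 1) :
    ∃ w : ℍ, w.re = 0 ∧ ‖w‖ ≤ Real.pi ∧ exp w = q := by
  have hnsq : normSq q = 1 := by rw [Quaternion.normSq_eq_norm_mul_self, hq, mul_one]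
  have hre_sq : q.re ^ 2 + ‖q.im‖ ^ 2 = 1 := by
    have h1 : ‖q.im‖ ^ 2 = normSq q.im := by rw [sq, ← Quaternion.normSq_eq_norm_mul_self]
    rw [h1]
    have := Quaternion.normSq_def' q
    have him := Quaternion.normSq_def' q.im
    simp only [Quaternion.re_im, Quaternion.imI_im, Quaternion.imJ_im, Quaternion.imK_im] at him
    nlinarith [hnsq]
  by_cases him : q.im = 0
  · -- `q = ± 1`
    have hq' : q = (q.re : ℍ) := by rw [← Quaternion.re_add_im q, him, add_zero]; simp
    have hre : q.re ^ 2 = 1 := by rw [him, norm_zero] at hre_sq; nlinarith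
    rcases eq_or_eq_neg_of_sq_eq_sq q.re 1 (by rw [hre, one_pow]) with h1 | h1
    · refine ⟨0, rfl, by simp [Real.pi_pos.le], ?_⟩
      rw [exp_zero, hq', h1]; simp
    · set v : ℍ := ⟨0, Real.pi, 0, 0⟩ with hv
      have hvre : v.re = 0 := rfl
      have hvnorm : ‖v‖ = Real.pi := by
        have h2 : ‖v‖ * ‖v‖ = Real.pi * Real.pi := by
          rw [← Quaternion.normSq_eq_norm_mul_self, Quaternion.normSq_def']
          simp [hv, sq]
        have hv0 : 0 ≤ ‖v‖ := norm_nonneg v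
        exact le_antisymm (by nlinarith [Real.pi_pos]) (by nlinarith [Real.pi_pos])
      refine ⟨v, hvre, hvnorm.le, ?_⟩
      rw [exp_of_re_eq_zero _ hvre, hvnorm, Real.cos_pi, Real.sin_pi, zero_div, zero_smul, add_zero, hq', h1]
  · -- generic case
    have hs : 0 < ‖q.im‖ := norm_pos_iff.mpr him
    set s : ℝ := ‖q.im‖ with hsdef
    set φ : ℝ := Real.arccos q.re with hφ
    have hr1 : -1 ≤ q.re := by nlinarith
    have hr2 : q.re ≤ 1 := by nlinarith
    have hcos : Real.cos φ = q.re := Real.cos_arccos hr1 hr2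
    have hsin : Real.sin φ = s := by
      rw [hφ, Real.sin_arccos]
      have : 1 - q.re ^ 2 = s ^ 2 := by linarith
      rw [this, Real.sqrt_sq hs.le]
    have hφ0 : 0 ≤ φ := Real.arccos_nonneg _
    have hφπ : φ ≤ Real.pi := Real.arccos_le_pi _
    have hφne : φ ≠ 0 := by
      intro h0
      have : Real.sin φ = 0 := by rw [h0, Real.sin_zero]
      rw [hsin] at this
      exact hs.ne' this
    refine ⟨(φ / s) • q.im, by simp, ?_, ?_⟩
    · rw [norm_smul, Real.norm_eq_abs, abs_of_nonneg (div_nonneg hφ0 hs.le), div_mul_cancel₀ _ hs.ne']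
      exact hφπ
    · have hre0 : ((φ / s) • q.im).re = 0 := by simp
      have hnorm : ‖(φ / s) • q.im‖ = φ := by
        rw [norm_smul, Real.norm_eq_abs, abs_of_nonneg (div_nonneg hφ0 hs.le), div_mul_cancel₀ _ hs.ne']
      rw [exp_of_re_eq_zero _ hre0, hnorm, hcos, hsin, smul_smul, div_mul_div_cancel₀ hφne, div_self hs.ne',
        one_smul, Quaternion.re_add_im]

/-- SMALL `K`-TH ROOTS IN `SU(2)`: every `g ∈ SU(2)` is the `K`-th power of an element within `π/K` of `1` in the operator norm
(the `dist1` of the tree's gauge-group structure on `SU(2)`). [folklore] -/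
theorem exists_pow_eq_dist1_le (g : Matrix.specialUnitaryGroup (Fin 2) ℂ) {K : ℕ} (hK : 1 ≤ K) :
    ∃ h : Matrix.specialUnitaryGroup (Fin 2) ℂ, h ^ K = g ∧ GaugeGroup.dist1 h ≤ Real.pi / K := by
  obtain ⟨w, hw0, hwπ, hexp⟩ := exists_exp_eq_of_norm_eq_one (su2Quat g) (norm_su2Quat g)
  have hK0 : (K : ℝ) ≠ 0 := by exact_mod_cast (show K ≠ 0 by omega)
  set u : ℍ := ((1 : ℝ) / K) • w with hu
  have hu0 : u.re = 0 := by simp [hu, hw0]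
  have hunorm : ‖u‖ ≤ Real.pi / K := by
    rw [hu, norm_smul, Real.norm_eq_abs, abs_of_nonneg (by positivity), one_div, ← div_eq_inv_mul]
    exact div_le_div_of_nonneg_right hwπ (by positivity)
  set x : ℍ := exp u with hx
  have hxnorm : ‖x‖ = 1 := by
    rw [hx, Quaternion.norm_exp, hu0]; simp
  letI : NormedAlgebra ℚ ℍ := NormedAlgebra.restrictScalars ℚ ℝ ℍ
  have hxK : x ^ K = su2Quat g := by
    rw [hx, ← exp_nsmul, hu, ← Nat.cast_smul_eq_nsmul ℝ, smul_smul]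
    rw [show (K : ℝ) * (1 / K) = 1 by field_simp, one_smul, hexp]
  refine ⟨quatToSU2 x, ?_, ?_⟩
  · -- `h ^ K = g` through the matrix model
    apply Subtype.ext
    have hpow : ∀ n : ℕ, ((quatToSU2 x ^ n : Matrix.specialUnitaryGroup (Fin 2) ℂ) : Matrix (Fin 2) (Fin 2) ℂ) =
        quatMatrix (x ^ n) := by
      intro n
      induction n with
      | zero => simp [quatMatrix_one]
      | succ n ih =>
        rw [pow_succ, pow_succ, quatMatrix_mul, ← ih, ← coe_quatToSU2_of_norm_eq_one hxnorm]
        rfl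
    rw [hpow K, hxK, quatMatrix_su2Quat]
  · -- `dist1 h = ‖quatMatrix x − 1‖ ≤ ‖u‖ ≤ π / K`
    have hdist : GaugeGroup.dist1 (quatToSU2 x) =
        ‖(quatToSU2 x : Matrix (Fin 2) (Fin 2) ℂ) - 1‖ := rfl
    rw [hdist, coe_quatToSU2_of_norm_eq_one hxnorm]
    -- `quatMatrix x − 1 = quatMatrix (x − 1)` and `‖quatMatrix y‖ ≤ ‖y‖`
    have hsub : quatMatrix x - 1 = quatMatrix (x - 1) := by
      rw [← quatMatrix_one]
      ext i j
      fin_cases i <;> fin_cases j <;> apply Complex.ext <;> simp [quatMatrix]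
    have hopnorm : ∀ y : ℍ, ‖quatMatrix y‖ ≤ ‖y‖ := by
      intro y
      by_cases hy : y = 0
      · rw [hy]
        have : quatMatrix 0 = 0 := by
          ext i j; fin_cases i <;> fin_cases j <;> apply Complex.ext <;> simp [quatMatrix]
        rw [this, norm_zero, norm_zero]
      · have hyn : 0 < ‖y‖ := norm_pos_iff.mpr hy
        have hunit : ‖‖y‖⁻¹ • y‖ = 1 := by
          rw [norm_smul, norm_inv, norm_norm, inv_mul_cancel₀ hyn.ne']
        have hmem := quatMatrix_mem_specialUnitaryGroup hunit
        have h1 : ‖quatMatrix (‖y‖⁻¹ • y)‖ = 1 :=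
          CStarRing.norm_of_mem_unitary ((Matrix.mem_specialUnitaryGroup_iff.mp hmem).1)
        have : quatMatrix y = ((‖y‖ : ℝ) : ℂ) • quatMatrix (‖y‖⁻¹ • y) := by
          rw [← quatMatrix_smul, smul_smul, mul_inv_cancel₀ hyn.ne', one_smul]
        rw [this, norm_smul, h1, mul_one, Complex.norm_real, Real.norm_eq_abs, abs_of_pos hyn]
    -- `‖x − 1‖ ≤ ‖u‖` for the exponential of an imaginary quaternion
    have hx1 : ‖x - 1‖ ≤ ‖u‖ := by
      rw [hx, exp_of_re_eq_zero u hu0]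
      by_cases hu00 : u = 0
      · rw [hu00]; simp
      have hun : 0 < ‖u‖ := norm_pos_iff.mpr hu00
      -- `cos‖u‖ + (sin‖u‖/‖u‖)•u − 1` has real part `cos‖u‖ − 1` and imaginary part `(sin‖u‖/‖u‖)•u`
      have hsq : ‖(↑(Real.cos ‖u‖) : ℍ) + (Real.sin ‖u‖ / ‖u‖) • u - 1‖ ^ 2 = 2 - 2 * Real.cos ‖u‖ := by
        rw [sq, ← Quaternion.normSq_eq_norm_mul_self, Quaternion.normSq_def']
        have hure : u.re = 0 := hu0
        have hun2 : u.imI ^ 2 + u.imJ ^ 2 + u.imK ^ 2 = ‖u‖ ^ 2 := by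
          rw [sq ‖u‖, ← Quaternion.normSq_eq_norm_mul_self, Quaternion.normSq_def', hure]; ring
        simp only [Quaternion.re_sub, Quaternion.re_add, Quaternion.re_coe, Quaternion.re_smul, hure,
          smul_eq_mul, mul_zero, add_zero, Quaternion.re_one, Quaternion.imI_sub, Quaternion.imI_add,
          Quaternion.imI_coe, Quaternion.imI_smul, zero_add, Quaternion.imI_one, sub_zero, Quaternion.imJ_sub,
          Quaternion.imJ_add, Quaternion.imJ_coe, Quaternion.imJ_smul, Quaternion.imJ_one, Quaternion.imK_sub,
          Quaternion.imK_add, Quaternion.imK_coe, Quaternion.imK_smul, Quaternion.imK_one]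
        have hcs := Real.sin_sq_add_cos_sq ‖u‖
        have : (Real.sin ‖u‖ / ‖u‖ * u.imI) ^ 2 + (Real.sin ‖u‖ / ‖u‖ * u.imJ) ^ 2 +
            (Real.sin ‖u‖ / ‖u‖ * u.imK) ^ 2 = Real.sin ‖u‖ ^ 2 := by
          rw [show (Real.sin ‖u‖ / ‖u‖ * u.imI) ^ 2 + (Real.sin ‖u‖ / ‖u‖ * u.imJ) ^ 2 +
              (Real.sin ‖u‖ / ‖u‖ * u.imK) ^ 2 = (Real.sin ‖u‖ / ‖u‖) ^ 2 * (u.imI ^ 2 + u.imJ ^ 2 + u.imK ^ 2) by ring,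
            hun2, div_pow, div_mul_cancel₀ _ (pow_ne_zero 2 hun.ne')]
        nlinarith [this]
      have hcosb : 1 - ‖u‖ ^ 2 / 2 ≤ Real.cos ‖u‖ := Real.one_sub_sq_div_two_le_cos
      have hnn : 0 ≤ ‖(↑(Real.cos ‖u‖) : ℍ) + (Real.sin ‖u‖ / ‖u‖) • u - 1‖ := norm_nonneg _
      nlinarith [hsq, hcosb, hnn, hun]
    calc ‖quatMatrix x - 1‖ = ‖quatMatrix (x - 1)‖ := by rw [hsub]
      _ ≤ ‖x - 1‖ := hopnorm _
      _ ≤ ‖u‖ := hx1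
      _ ≤ Real.pi / K := hunorm

/-! ## §6 Arbitrary gauge transformations in `SU(2)`: `K`-th roots, `K` small transformations in a row -/

section SU2

open Literature.MathematicalPhysics.QuantumFieldTheory.Balaban1983to89

variable {P : Params} {j : ℕ}

/-- EVERY GAUGE TRANSFORMATION IS A CHAIN (gauge group `SU(2)`): if `PlaqSmall θ₀ A` and `θ₀ < θ`, then `A` is joined to `A^u` by at most
`#PBond · (⌈8π/(θ − θ₀)⌉₊ + 1)` one-bond moves inside `PlaqSmall θ` — write `u = v^K` with every `v x` within `π/K ≤ (θ − θ₀)/8` of `1`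
(`exists_pow_eq_dist1_le`) and apply `chain_gaugeAct_of_small` `K` times (`A^{v^k}` stays in `PlaqSmall θ₀`). [folklore] -/
theorem chain_gaugeAct_su2 (θ₀ θ : ℝ) (hθ : θ₀ < θ) (A : GaugeField P j (Matrix.specialUnitaryGroup (Fin 2) ℂ))
    (hA : PlaqSmall θ₀ A) (u : GaugeTransf P j (Matrix.specialUnitaryGroup (Fin 2) ℂ)) :
    ∃ (n : ℕ) (W : ℕ → GaugeField P j (Matrix.specialUnitaryGroup (Fin 2) ℂ)),
      n ≤ Fintype.card (PBond P j) * (⌈8 * Real.pi / (θ - θ₀)⌉₊ + 1) ∧ W 0 = A ∧ W n = GaugeField.gaugeAct u A ∧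
      (∀ i, i ≤ n → PlaqSmall θ (W i)) ∧ (∀ i, i < n → ∃ b : PBond P j, ∀ e, e ≠ b → W i e = W (i + 1) e) := by
  set K : ℕ := ⌈8 * Real.pi / (θ - θ₀)⌉₊ + 1 with hKdef
  have hK1 : 1 ≤ K := by omega
  have hKpos : (0 : ℝ) < K := by exact_mod_cast hK1
  set σ : ℝ := Real.pi / K with hσ
  have hσ0 : 0 ≤ σ := by positivity
  have hσθ : θ₀ + 8 * σ ≤ θ := by
    have h1 : 8 * Real.pi / (θ - θ₀) ≤ K := by
      rw [hKdef]; push_cast; linarith [Nat.le_ceil (8 * Real.pi / (θ - θ₀))]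
    have h2 : 8 * Real.pi ≤ K * (θ - θ₀) := by rwa [div_le_iff₀ (by linarith)] at h1
    have h3 : 8 * σ = 8 * Real.pi / K := by rw [hσ]; ring
    rw [h3, add_comm, ← le_sub_iff_add_le, div_le_iff₀ hKpos]
    linarith
  -- the `K`-th roots, site by site
  choose v hvK hvσ using fun x => exists_pow_eq_dist1_le (u x) hK1
  have hu : u = fun x => v x ^ K := funext fun x => (hvK x).symm
  -- `k` small gauge transformations in a row
  have hstep : ∀ k : ℕ, ∃ (n : ℕ) (W : ℕ → GaugeField P j (Matrix.specialUnitaryGroup (Fin 2) ℂ)),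
      n ≤ Fintype.card (PBond P j) * k ∧ W 0 = A ∧ W n = GaugeField.gaugeAct (fun x => v x ^ k) A ∧
      (∀ i, i ≤ n → PlaqSmall θ (W i)) ∧ (∀ i, i < n → ∃ b : PBond P j, ∀ e, e ≠ b → W i e = W (i + 1) e) := by
    intro k
    induction k with
    | zero =>
      refine ⟨0, fun _ => A, le_rfl, rfl, ?_, fun i _ p => (hA p).trans hθ, fun i hi => (Nat.not_lt_zero i hi).elim⟩
      funext b; simp [GaugeField.gaugeAct]
    | succ k ih =>
      have hAk : PlaqSmall θ₀ (GaugeField.gaugeAct (fun x => v x ^ k) A) := (B12RegularClassInvariance263.plaqSmall_gaugeAct_iff θ₀ _ A).mpr hA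
      have h2 := chain_gaugeAct_of_small θ₀ θ hσ0 hσθ _ hAk v hvσ
      have heq : GaugeField.gaugeAct v (GaugeField.gaugeAct (fun x => v x ^ k) A) =
          GaugeField.gaugeAct (fun x => v x ^ (k + 1)) A := by
        rw [← gaugeAct_mul']; simp only [pow_succ']
      rw [heq] at h2
      have h := chain_trans ih h2
      simpa only [Nat.mul_succ] using h
  rw [hu]
  exact hstep K

/-- PURE GAUGES ARE CHAINS FROM `1` (gauge group `SU(2)`): for every `θ > 0` and every gauge transformation `u`, the trivial configuration is
joined to the pure gauge `1^u` by at most `#PBond · (⌈16π/θ⌉₊ + 1)` one-bond moves inside `PlaqSmall θ` — in the chain format of the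
registered stub `stub_innerWindowChains` of `FlatRatioTermination` (stmt-QuantumFields-22542). [folklore] -/
theorem chain_one_gaugeAct_su2 (θ : ℝ) (hθ : 0 < θ) (u : GaugeTransf P j (Matrix.specialUnitaryGroup (Fin 2) ℂ)) :
    ∃ (n : ℕ) (W : ℕ → GaugeField P j (Matrix.specialUnitaryGroup (Fin 2) ℂ)),
      n ≤ Fintype.card (PBond P j) * (⌈16 * Real.pi / θ⌉₊ + 1) ∧ (∀ e, W 0 e = 1) ∧ W n = GaugeField.gaugeAct u 1 ∧
      (∀ i, i ≤ n → PlaqSmall θ (W i)) ∧ (∀ i, i < n → ∃ b : PBond P j, ∀ e, e ≠ b → W i e = W (i + 1) e) := by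
  have h1 : PlaqSmall (θ / 2) (1 : GaugeField P j (Matrix.specialUnitaryGroup (Fin 2) ℂ)) := by
    intro p
    have : GaugeField.plaqHol (1 : GaugeField P j (Matrix.specialUnitaryGroup (Fin 2) ℂ)) p = 1 := by
      simp [GaugeField.plaqHol, show ∀ e, (1 : GaugeField P j (Matrix.specialUnitaryGroup (Fin 2) ℂ)) e = 1 from fun _ => rfl]
    rw [this, GaugeGroup.dist1_one]; linarith
  obtain ⟨n, W, hn, hW0, hWn, hS, hst⟩ := chain_gaugeAct_su2 (θ / 2) θ (by linarith) 1 h1 u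
  refine ⟨n, W, ?_, fun e => by rw [hW0]; rfl, hWn, hS, hst⟩
  have : θ - θ / 2 = θ / 2 := by ring
  rw [this, show 8 * Real.pi / (θ / 2) = 16 * Real.pi / θ by field_simp; ring] at hn
  exact hn

end SU2

end Summit.QuantumFields.YangMills.Theorems.FlatRatioTermination
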